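/-
Copyright (c) 2026 the pub-hodgecm-mathlib formalisation cell (harness21).  Prover seat hodgecm-mathlib-K2Liu-p05 (g0): Track B «K2-LIT»,
#184♮ = hLiu418 = stmt-HodgeConjecture-24832; socket #32s `sig_K2LiuZetaSHolomorphic` of the tier-1 socket module
`Cruxes/HLiu418/Lines/K2_Liu_CurveThetaSigs_U5d_ZetaS.lean` (ED. 1, K2Liu-plan (g2) cand v2 a836627a4002dcd3 :277; LEAD F0P6-plan (g10)
BOX 2026-09-04T01:42:07Z, DEAL l.72556 ∕ l.72557, K2Liu-ref1 (g1) BOX #31 PASS); 2026-09-04.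
-/
import Literature.NumberTheory.K2Lit.LocalDoublingZeta                                          -- ★ D7b: `zetaS ∕ ZetaSConverges ∕ placesEmbed ∕ continuous_placesEmbed`
import Literature.NumberTheory.K2Lit.SiegelStandardSections                                      -- ★ D1′: `IwasawaDatum ∕ IsStandardSectionFamily`
import Literature.Analysis.Complex.HolomorphicParametricIntegral                                 -- ★ `differentiableOn_integral_of_dominated` (no derivative hypothesis)
import Summits.HodgeConjecture.HodgeConjecture.Theorems.K2LiuDoublingUnfoldBridge                -- ★ H5 (K2Liu-p01): `exists_continuousMulEquiv_eq_iotaA` (`ιA` is a `≃ₜ*`)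
import Summits.HodgeConjecture.HodgeConjecture.Theorems.K2LiuQuotMatrixCoeffContinuous           -- ★ (K2Liu-p09): `continuous_quotMatrixCoeff ∕ exists_norm_quotMatrixCoeff_le`
import Summits.HodgeConjecture.HodgeConjecture.Theorems.K2LiuSiegelEisensteinDoubledSummableReduction  -- ★ (K2Liu-p09): `norm_apply_siegelDelta_mul` (unitary `χ`)
import HarnessLib

/-!
# Crux `HLiu418`, Track B road `K2_Liu`, unit U5d «`Z_S`», socket #32s:
# ABSOLUTE CONVERGENCE AND HOLOMORPHY OF THE `S`-PART OF THE DOUBLING ZETA INTEGRAL ON `{N∕2 − 1 < Re s}` (organ (LS5a)(ii))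

Cell `hodgecm-mathlib`, crux item hLiu418 = `stmt-HodgeConjecture-24832`, route of record `HCCMUnconditional`; squad K2 ∕ K2Liu,
LEAD F0P6-plan (g10), planner K2Liu-plan (g2), prover K2Liu-p05 (g0).  THEOREMS ONLY (no `def`, no instance, no notation, no
named-fact hypothesis, no `sorry`, default heartbeats); lane `--supports stmt-HodgeConjecture-24832 --as helper` (count-neutral).

WHAT IS PROVED.  `zetaSHolomorphic` — statement bytes = the socket
`Summit.HodgeConjecture.HodgeConjecture.Cruxes.HLiu418.K2LiuCurveThetaSigsU5dZetaS.sig_K2LiuZetaSHolomorphic` VERBATIM: in the `M = 1`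
frame, for a unitary `χ`, a STANDARD family `f` (Iwasawa datum `𝒦`) with every `f_s` continuous, continuous `s`-independent slots `φ₁, φ₂`
on the compact quotient `[G]`, the tier-0 bridge `ιA` (pinned by `_hιA`), and a continuous height `Φ > 0` of type `(P_Δ, modDelta)` whose
pull-back to `G_∞ × G_S` has integrable `τ`-th powers for `τ > 2N − 2` (socket #32d, BY VALUE): `Z_S(f_s, φ₁, φ₂)` converges absolutely for
`Re s > N∕2 − 1` (★ `ZetaSConverges`) and `s ↦ Z_S(f_s, φ₁, φ₂)` (★ `zetaS`) is HOLOMORPHIC on `{N∕2 − 1 < Re s}`.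

PROOF ([Liu2011, §2B Prop. 2.3 p. 862]; [GelbartPiatetskishapiroRallis1987, Part A §6]; the majorant is Godement's, [Garrett2018, §3.10]).
§1 real-power bookkeeping: `t^τ ≤ t^a + t^b` for `a ≤ τ ≤ b`, `t > 0`.  §2 THE UNIFORM MAJORANT: on `H(𝔸) = P_Δ(𝔸)·K` write `x = p k`;
flatness (`f_s|_K = f_{s₀}|_K`) and the section law give `‖f_s(x)‖ = modDelta(p)^{2 Re s + n} ‖f_{s₀}(k)‖` (★ `norm_apply_siegelDelta_mul`),
`modDelta(p) = Φ(x)∕Φ(k)`, and `Φ(k)^{−a} ≤ D_a` on the compact `K`; hence for `a ≤ 2 Re s + n ≤ b`: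
`‖f_s(x)‖ ≤ B·(D_a Φ(x)^a + D_b Φ(x)^b)` with `B = sup_K ‖f_{s₀}‖` — ONE integrable majorant for all `s` in a ball.  §3 the payment:
the integrand `x ↦ f_s(ι(ιA x_{∞S}, 1))·⟨π(x_{∞S})φ₁, φ₂⟩` is continuous on `G_∞ × G_S` (★ `continuous_iotaLeft`, `ιA` = the ★ similitude
`≃ₜ*`, ★ `continuous_placesEmbed`, ★ `continuous_quotMatrixCoeff`; Borel measurability on the product through second countability of the
`U(H)(L⁺_v)`, ★ `secondCountableTopology_localPi`), `⟨π(·)φ₁, φ₂⟩` is bounded (★ `exists_norm_quotMatrixCoeff_le`), and `s ↦ f_s(h)` is entire;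
for `s₀` with `Re s₀ > N∕2 − 1` take `R = (Re s₀ − N∕2 + 1)∕2`, `a = 2(Re s₀ − R) + N > 2N − 2`, `b = 2(Re s₀ + R) + N`: on `ball s₀ R` the
integrand is dominated by `B·M_Q·(D_a Φ^a + D_b Φ^b) ∘ ι ∘ ιA ∘ placesEmbed`, integrable by `_hdecay a` and `_hdecay b`; convergence is
`Integrable.mono'`, holomorphy is ★ `Literature.Analysis.Complex.differentiableOn_integral_of_dominated` (Cauchy estimates supply the
derivative — no derivative field is ever written).  `n = N` from `e : Fin N × Fin 1 ≃ Fin n`.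

DEGENERATE CORNERS (as on the socket): `N = 0` ✓ (then `2 Re s + n` may be NEGATIVE on `{−1 < Re s}` — §2 is stated for every real
exponent, no `0 ≤ τ` needed); `S = ∅` ✓ (`Measure.pi` over the empty index); `f = 0` ✓; the open half-plane is never left (the ball of
radius `R` sits inside it); `_hιA` is used exactly once (continuity of `ιA`).

HONEST LABEL.  Count-neutral helper of the K2_Liu road; it pays socket #32s by name once U5d ED. 1 is written and re-tied, and retires
nothing else: `HC_CM` is proved only modulo the 7 printed citations (2 remaining named inputs: hLiu418 = `stmt-HodgeConjecture-24832`,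
h413 = `stmt-HodgeConjecture-24833`) until rung 0 closes.

## References
* [Liu2011] Y. Liu, *Arithmetic theta lifting and L-derivatives for unitary groups I*, Algebra Number Theory 5 (2011): §2B Prop. 2.3 p. 862.
* [GelbartPiatetskishapiroRallis1987] S. Gelbart, I. Piatetski-Shapiro, S. Rallis, *Explicit constructions of automorphic L-functions*,
  LNM 1254 (1987): Part A §6.
* [Garrett2018] P. Garrett, *Modern Analysis of Automorphic Forms by Example* (2018): §3.10 (domination by a height on a Siegel set).
* [BorelJacquet1979] A. Borel, H. Jacquet, *Automorphic forms and automorphic representations*, PSPM 33.1 (1979): §4.1, §4.6.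
-/

set_option autoImplicit false
-- the mandated namespace repeats the single-problem summit's segment (`HodgeConjecture.HodgeConjecture`)
set_option linter.dupNamespace false

noncomputable section

open scoped Matrix
open NumberField IsDedekindDomain MeasureTheory Metric Filter

namespace Summit.HodgeConjecture.HodgeConjecture.Cruxes.HLiu418.K2LiuZetaSHolomorphic

open Literature.NumberTheory.Automorphic Literature.NumberTheory.GaloisRepresentations
open Literature.NumberTheory.GelbartRogawski1991 Literature.NumberTheory.GelbartRogawski1991.GRConstruction
open Literature.NumberTheory.K2Lit.SiegelDoubled
open Literature.NumberTheory.K2Lit.PlaceSplitting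
open Summit.HodgeConjecture.HodgeConjecture.Cruxes.HLiu418.K2LiuDoublingUnfoldBridge
open Summit.HodgeConjecture.HodgeConjecture.Cruxes.HLiu418.K2LiuQuotMatrixCoeffContinuous
open Summit.HodgeConjecture.HodgeConjecture.Cruxes.HLiu418.K2LiuSiegelEisensteinDoubledSummableReduction

variable (L : Type) [Field L] [NumberField L] [IsCMField L]
variable {N M n : ℕ} (e : Fin N × Fin M ≃ Fin n)
  (dV : Fin N → L) (hdV : ∀ i, IsCMField.complexConj L (dV i) = dV i)
  (dW : Fin M → L) (hdW : ∀ i, IsCMField.complexConj L (dW i) = dW i)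

/-! ## §1 Real-power bookkeeping -/

/-- For `t > 0` and `a ≤ τ ≤ b`: `t ^ τ ≤ t ^ a + t ^ b` (the larger end dominates for `t ≥ 1`, the smaller one for `t ≤ 1`).
[cite: Garrett2018, §3.10] -/
theorem rpow_le_rpow_add_rpow {t a b τ : ℝ} (ht : 0 < t) (ha : a ≤ τ) (hb : τ ≤ b) :
    t ^ τ ≤ t ^ a + t ^ b := by
  rcases le_or_gt 1 t with h1 | h1
  · exact le_add_of_nonneg_of_le (Real.rpow_nonneg ht.le a) (Real.rpow_le_rpow_of_exponent_le h1 hb)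
  · exact le_add_of_le_of_nonneg (Real.rpow_le_rpow_of_exponent_ge ht h1.le ha) (Real.rpow_nonneg ht.le b)

/-- `n = N·M` for an enumeration `e : Fin N × Fin M ≃ Fin n` (so `n = N` in the `M = 1` frame). [cite: Liu2011, §2B p. 862] -/
theorem card_eq_of_equiv (eNM : Fin N × Fin M ≃ Fin n) : n = N * M := by
  have h := Fintype.card_congr eNM
  simpa [Fintype.card_prod, Fintype.card_fin] using h.symm

/-! ## §2 The uniform majorant of a standard family by two powers of a `P_Δ`-height -/

/-- On a compact set a negative power of a continuous positive height is bounded: `Φ(k)^{−a} ≤ D` on `K`, `D > 0`.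
[cite: Garrett2018, §3.10] -/
theorem exists_rpow_neg_le_on {K : Set (HA L e dV hdV dW hdW)} (hK : IsCompact K)
    {Φ : HA L e dV hdV dW hdW → ℝ} (hΦc : Continuous Φ) (hΦpos : ∀ x, 0 < Φ x) (a : ℝ) :
    ∃ D : ℝ, 0 < D ∧ ∀ k ∈ K, Φ k ^ (-a) ≤ D := by
  obtain ⟨D, hD⟩ := hK.exists_bound_of_continuousOn
    ((hΦc.rpow_const (p := -a) fun x => Or.inl (hΦpos x).ne').continuousOn)
  refine ⟨max D 1, lt_of_lt_of_le one_pos (le_max_right _ _), fun k hk => ?_⟩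
  have h := hD k hk
  rw [Real.norm_eq_abs] at h
  exact (le_abs_self _).trans (h.trans (le_max_left _ _))

/-- **One exponent.**  If `Φ` is a height of type `(P_Δ, modDelta)` and `Φ(k)^{−a} ≤ D` on `K`, then for `p ∈ P_Δ(𝔸)`, `k ∈ K`:
`modDelta(p)^a ≤ D · Φ(p k)^a` (`modDelta(p) = Φ(pk)∕Φ(k)`). [cite: Garrett2018, §3.10] [cite: Liu2011, §2B Prop. 2.3 p. 862] -/
theorem modDelta_rpow_le {Φ : HA L e dV hdV dW hdW → ℝ} (hΦpos : ∀ x, 0 < Φ x)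
    (hΦ : ∀ p x : HA L e dV hdV dW hdW, IsSiegelDelta L e dV hdV dW hdW p →
      Φ (p * x) = modDelta L e dV hdV dW hdW p * Φ x)
    {K : Set (HA L e dV hdV dW hdW)} {a D : ℝ} (hD : ∀ k ∈ K, Φ k ^ (-a) ≤ D)
    {p k : HA L e dV hdV dW hdW} (hp : IsSiegelDelta L e dV hdV dW hdW p) (hk : k ∈ K) :
    modDelta L e dV hdV dW hdW p ^ a ≤ D * Φ (p * k) ^ a := by
  have hΦx : Φ (p * k) = modDelta L e dV hdV dW hdW p * Φ k := hΦ p k hp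
  have hm : modDelta L e dV hdV dW hdW p = Φ (p * k) / Φ k := by
    rw [hΦx, mul_div_cancel_right₀ _ (hΦpos k).ne']
  rw [hm, Real.div_rpow (hΦpos _).le (hΦpos k).le, div_eq_mul_inv, ← Real.rpow_neg (hΦpos k).le, mul_comm]
  exact mul_le_mul_of_nonneg_right (hD k hk) (Real.rpow_nonneg (hΦpos _).le a)

/-- **THE UNIFORM MAJORANT (two exponents).**  `χ` unitary, `f` a standard family for the Iwasawa datum `𝒦`, `‖f_{s₀}‖ ≤ B` on `𝒦.K`,
`Φ > 0` a height of type `(P_Δ, modDelta)` with `Φ^{−a} ≤ D_a`, `Φ^{−b} ≤ D_b` on `𝒦.K`.  Then for EVERY `s` with `a ≤ 2 Re s + n ≤ b` and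
every `x ∈ H(𝔸)`: `‖f_s(x)‖ ≤ B·(D_a Φ(x)^a + D_b Φ(x)^b)` (Iwasawa `x = p k`, ★ `norm_apply_siegelDelta_mul`, flatness `f_s(k) = f_{s₀}(k)`,
§1).  No sign condition on the exponents. [cite: Liu2011, §2B Prop. 2.3 p. 862] [cite: Garrett2018, §3.10] [cite: GelbartPiatetskishapiroRallis1987, Part A §6] -/
theorem norm_apply_le_two_rpow {χ : HeckeCharacter L} (hχ : χ.IsUnitary) {𝒦 : IwasawaDatum L e dV hdV dW hdW}
    {f : ℂ → HA L e dV hdV dW hdW → ℂ} (hf : IsStandardSectionFamily 𝒦 χ f) (s₀ : ℂ) {B : ℝ}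
    (hB : ∀ k ∈ 𝒦.K, ‖f s₀ k‖ ≤ B)
    {Φ : HA L e dV hdV dW hdW → ℝ} (hΦpos : ∀ x, 0 < Φ x)
    (hΦ : ∀ p x : HA L e dV hdV dW hdW, IsSiegelDelta L e dV hdV dW hdW p →
      Φ (p * x) = modDelta L e dV hdV dW hdW p * Φ x)
    {a b Da Db : ℝ} (hDa : ∀ k ∈ 𝒦.K, Φ k ^ (-a) ≤ Da) (hDb : ∀ k ∈ 𝒦.K, Φ k ^ (-b) ≤ Db)
    {s : ℂ} (ha : a ≤ 2 * s.re + (n : ℝ)) (hb : 2 * s.re + (n : ℝ) ≤ b) (x : HA L e dV hdV dW hdW) :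
    ‖f s x‖ ≤ B * (Da * Φ x ^ a + Db * Φ x ^ b) := by
  obtain ⟨p, k, hp, hk, rfl⟩ := 𝒦.iwasawa x
  rw [norm_apply_siegelDelta_mul L e dV hdV dW hdW hχ (hf.1.1 s) hp k, hf.2.2 k hk s s₀]
  have hB0 : 0 ≤ B := (norm_nonneg _).trans (hB k hk)
  have hm : 0 < modDelta L e dV hdV dW hdW p := modDelta_pos L e dV hdV dW hdW p
  calc modDelta L e dV hdV dW hdW p ^ (2 * s.re + (n : ℝ)) * ‖f s₀ k‖
      ≤ (modDelta L e dV hdV dW hdW p ^ a + modDelta L e dV hdV dW hdW p ^ b) * B :=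
        mul_le_mul (rpow_le_rpow_add_rpow hm ha hb) (hB k hk) (norm_nonneg _)
          (add_nonneg (Real.rpow_nonneg hm.le a) (Real.rpow_nonneg hm.le b))
    _ ≤ (Da * Φ (p * k) ^ a + Db * Φ (p * k) ^ b) * B :=
        mul_le_mul_of_nonneg_right
          (add_le_add (modDelta_rpow_le L e dV hdV dW hdW hΦpos hΦ hDa hp hk)
            (modDelta_rpow_le L e dV hdV dW hdW hΦpos hΦ hDb hp hk)) hB0
    _ = B * (Da * Φ (p * k) ^ a + Db * Φ (p * k) ^ b) := mul_comm _ _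

/-! ## §3 The payment of socket #32s -/

/-- **PAYMENT OF `sig_K2LiuZetaSHolomorphic`** (socket #32s of unit U5d «`Z_S`», ED. 1 :277, TOKEN FOR TOKEN; organ (LS5a)(ii) of the local seam of
s23).  **ABSOLUTE CONVERGENCE AND HOLOMORPHY OF THE `S`-PART OF THE DOUBLING ZETA INTEGRAL.**  In the `M = 1` frame, for a unitary `χ`, a
STANDARD family `f` (Iwasawa datum `𝒦`) with every `f_s` continuous, continuous `s`-independent slots `φ₁, φ₂` on the compact quotient
`[G] = G(L⁺)\G(𝔸)`, the tier-0 `ιA` and a continuous height `Φ > 0` of type `(P_Δ, modDelta)` whose pull-back to `G_∞ × G_S` has integrable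
`τ`-th powers for `τ > 2N − 2` (#32d BY VALUE): for every `s` with `Re s > N∕2 − 1` the integral
`Z_S(f_s, φ₁, φ₂) = ∫_{G_∞×G_S} f_s(ι(ιA x, 1)) ⟨π(x)φ₁, φ₂⟩ dx` converges absolutely (★ `ZetaSConverges`), and `s ↦ Z_S(f_s, φ₁, φ₂)` (★ `zetaS`)
is HOLOMORPHIC on `{N∕2 − 1 < Re s}` (`= {0 < Re s} ∋ ½` for `N = 2`).  Proof: §2's uniform majorant on balls inside the half-plane +
★ `Literature.Analysis.Complex.differentiableOn_integral_of_dominated`.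
[cite: Liu2011, §2B Prop. 2.3 p. 862] [cite: Yamana2014, §7] [cite: HarrisKudlaSweet1996, §6] [cite: KudlaRallis1994, §1]
[cite: GelbartPiatetskishapiroRallis1987, Part A §6] -/
theorem zetaSHolomorphic :
    ∀ (L : Type) [Field L] [NumberField L] [IsCMField L] {N n : ℕ} (e : Fin N × Fin 1 ≃ Fin n)
      (dV : Fin N → L) (hdV : ∀ i, IsCMField.complexConj L (dV i) = dV i) (_hdV0 : ∀ i, dV i ≠ 0)
      (dW : Fin 1 → L) (hdW : ∀ i, IsCMField.complexConj L (dW i) = dW i) (_hdW0 : ∀ i, dW i ≠ 0)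
      (H : Matrix (Fin N) (Fin N) L)
      (t : L) (_ht : t ≠ 0) (g : GL (Fin N) L)
      (_hg : formCongr ((IsCMField.complexConj L : L ≃ₐ[↥(maximalRealSubfield L)] L) : L →+* L) g (t • H) = Matrix.diagonal dV)
      (ιA : (UnitaryGroup.adelicGroupData (Fp L) L (IsCMField.complexConj L) N H).Adelic →*
        UnitaryGroup.adelic (Fp L) L (IsCMField.complexConj L) N (Matrix.diagonal dV))
      (_hιA : ∀ k, ((ιA k : ↥(UnitaryGroup.adelic (Fp L) L (IsCMField.complexConj L) N (Matrix.diagonal dV))) :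
            GL (Fin N) (AdeleRing (𝓞 L) L)) =
          (toAdeleGL L g)⁻¹ * UnitaryGroup.adelicVal (Fp L) L (IsCMField.complexConj L) N H k * toAdeleGL L g)
      (S : Finset (HeightOneSpectrum (𝓞 (Fp L)))) [DecidableEq (HeightOneSpectrum (𝓞 (Fp L)))]
      [MeasurableSpace (UnitaryGroup.arch (Fp L) L (IsCMField.complexConj L) N H)]
      [BorelSpace (UnitaryGroup.arch (Fp L) L (IsCMField.complexConj L) N H)]
      [∀ v : HeightOneSpectrum (𝓞 (Fp L)), MeasurableSpace (UnitaryGroup.localPi L (IsCMField.complexConj L) N H v)]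
      [∀ v : HeightOneSpectrum (𝓞 (Fp L)), BorelSpace (UnitaryGroup.localPi L (IsCMField.complexConj L) N H v)]
      (νinf : Measure (UnitaryGroup.arch (Fp L) L (IsCMField.complexConj L) N H)) [νinf.IsHaarMeasure]
      (νS : ∀ v : S, Measure (UnitaryGroup.localPi L (IsCMField.complexConj L) N H v.1)) [∀ v, (νS v).IsHaarMeasure]
      (μ : Measure (UnitaryGroup.adelicGroupData (Fp L) L (IsCMField.complexConj L) N H).automorphicQuotient)
      [(UnitaryGroup.adelicGroupData (Fp L) L (IsCMField.complexConj L) N H).IsAutomorphicMeasure μ]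
      [CompactSpace (UnitaryGroup.adelicGroupData (Fp L) L (IsCMField.complexConj L) N H).automorphicQuotient]
      (χ : HeckeCharacter L) (_hχu : χ.IsUnitary)
      (𝒦 : IwasawaDatum L e dV hdV dW hdW) (f : ℂ → HA L e dV hdV dW hdW → ℂ) (_hf : IsStandardSectionFamily 𝒦 χ f)
      (_hfc : ∀ s, Continuous (f s))
      -- a continuous height of type `(P_Δ, modDelta)` with the sharp local decay of #32d (by value)
      (Φ : HA L e dV hdV dW hdW → ℝ) (_hΦc : Continuous Φ) (_hΦpos : ∀ x, 0 < Φ x)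
      (_hΦ : ∀ p x : HA L e dV hdV dW hdW, IsSiegelDelta L e dV hdV dW hdW p →
        Φ (p * x) = modDelta L e dV hdV dW hdW p * Φ x)
      (_hdecay : ∀ τ : ℝ, 2 * (N : ℝ) - 2 < τ →
        Integrable (fun x => Φ (iotaLeft L e dV hdV dW hdW (ιA (placesEmbed L H S x))) ^ τ) (νinf.prod (Measure.pi νS)))
      (φ₁ φ₂ : (UnitaryGroup.adelicGroupData (Fp L) L (IsCMField.complexConj L) N H).automorphicQuotient → ℂ)
      (_hφ₁ : Continuous φ₁) (_hφ₂ : Continuous φ₂),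
      (∀ s : ℂ, (N : ℝ) / 2 - 1 < s.re → ZetaSConverges L e dV hdV dW hdW H S νinf νS μ ιA (f s) φ₁ φ₂) ∧
        DifferentiableOn ℂ (fun s => zetaS L e dV hdV dW hdW H S νinf νS μ ιA (f s) φ₁ φ₂) {s : ℂ | (N : ℝ) / 2 - 1 < s.re} := by
  intro L _ _ _ N n e dV hdV _hdV0 dW hdW _hdW0 H t ht g hg ιA hιA S _ _ _ _ _ νinf _ νS _ μ _ _ χ hχu 𝒦 f hf hfc Φ hΦc hΦpos hΦ
    hdecay φ₁ φ₂ hφ₁ hφ₂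
  -- `n = N`
  have hnN : (n : ℝ) = (N : ℝ) := by
    have h := card_eq_of_equiv e
    rw [mul_one] at h
    exact_mod_cast h
  -- Borel bookkeeping on `G_∞ × G_S`: the finite product of the second countable `U(H)(L⁺_v)` is second countable
  haveI : ∀ v, SecondCountableTopology (UnitaryGroup.localPi L (IsCMField.complexConj L) N H v) :=
    fun v => UnitaryGroup.secondCountableTopology_localPi L N (IsCMField.complexConj L) H v
  haveI : SecondCountableTopology (Π v : S, UnitaryGroup.localPi L (IsCMField.complexConj L) N H v.1) := inferInstance
  haveI : SecondCountableTopologyEither (UnitaryGroup.arch (Fp L) L (IsCMField.complexConj L) N H)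
      (Π v : S, UnitaryGroup.localPi L (IsCMField.complexConj L) N H v.1) := secondCountableTopologyEither_of_right _ _
  haveI : SecondCountableTopology (UnitaryGroup.adelicGroupData (Fp L) L (IsCMField.complexConj L) N H).Adelic :=
    inferInstanceAs (SecondCountableTopology (UnitaryGroup.adelic (Fp L) L (IsCMField.complexConj L) N H))
  -- `ιA` IS the ★ similitude isomorphism, hence continuous
  obtain ⟨Ψ, -, hΨ⟩ := exists_continuousMulEquiv_eq_iotaA L H dV t ht g hg ιA hιA
  have hιc : Continuous ιA := by
    have h : (ιA : _ → _) = Ψ := funext fun x => (hΨ x).symm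
    rw [h]
    exact Ψ.continuous
  -- the argument `x ↦ ι(ιA x_{∞S}, 1)` and the matrix coefficient are continuous; the latter is bounded
  have hh : Continuous fun x : UnitaryGroup.arch (Fp L) L (IsCMField.complexConj L) N H ×
      (Π v : S, UnitaryGroup.localPi L (IsCMField.complexConj L) N H v.1) =>
        iotaLeft L e dV hdV dW hdW (ιA (placesEmbed L H S x)) :=
    (continuous_iotaLeft L e dV hdV dW hdW).comp (hιc.comp (continuous_placesEmbed L H S))
  have hQc : Continuous (quotMatrixCoeff (UnitaryGroup.adelicGroupData (Fp L) L (IsCMField.complexConj L) N H) μ φ₁ φ₂) :=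
    continuous_quotMatrixCoeff _ μ hφ₁ hφ₂
  obtain ⟨MQ, hMQ⟩ := exists_norm_quotMatrixCoeff_le
    (UnitaryGroup.adelicGroupData (Fp L) L (IsCMField.complexConj L) N H) μ hφ₁ hφ₂
  have hMQ0 : 0 ≤ MQ := (norm_nonneg _).trans (hMQ 1)
  -- `‖f₀‖ ≤ B` on the compact `K` (flatness makes this a bound for every `f_s|_K`)
  obtain ⟨B, hB⟩ := 𝒦.isCompact_K.exists_bound_of_continuousOn (hfc 0).continuousOn
  have hB0 : 0 ≤ B := (norm_nonneg _).trans (hB 1 𝒦.one_mem)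
  -- the integrand `F s x` and its measurability
  set F : ℂ → UnitaryGroup.arch (Fp L) L (IsCMField.complexConj L) N H ×
      (Π v : S, UnitaryGroup.localPi L (IsCMField.complexConj L) N H v.1) → ℂ :=
    fun s x => f s (iotaLeft L e dV hdV dW hdW (ιA (placesEmbed L H S x))) *
      quotMatrixCoeff (UnitaryGroup.adelicGroupData (Fp L) L (IsCMField.complexConj L) N H) μ φ₁ φ₂ (placesEmbed L H S x)
    with hFdef
  have hFm : ∀ s, AEStronglyMeasurable (F s) (νinf.prod (Measure.pi νS)) := fun s =>
    (((hfc s).comp hh).mul (hQc.comp (continuous_placesEmbed L H S))).aestronglyMeasurable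
  -- THE DOMINATION on balls inside the half-plane
  have hdom : ∀ s₀ ∈ {s : ℂ | (N : ℝ) / 2 - 1 < s.re}, ∃ R : ℝ, 0 < R ∧ ball s₀ R ⊆ {s : ℂ | (N : ℝ) / 2 - 1 < s.re} ∧
      ∃ bound : UnitaryGroup.arch (Fp L) L (IsCMField.complexConj L) N H ×
          (Π v : S, UnitaryGroup.localPi L (IsCMField.complexConj L) N H v.1) → ℝ,
        Integrable bound (νinf.prod (Measure.pi νS)) ∧ ∀ x, ∀ s ∈ ball s₀ R, ‖F s x‖ ≤ bound x := by
    intro s₀ hs₀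
    simp only [Set.mem_setOf_eq] at hs₀
    set R : ℝ := (s₀.re - ((N : ℝ) / 2 - 1)) / 2 with hR
    have hR0 : 0 < R := by rw [hR]; linarith
    set a : ℝ := 2 * (s₀.re - R) + (n : ℝ) with ha
    set b : ℝ := 2 * (s₀.re + R) + (n : ℝ) with hb
    have ha' : 2 * (N : ℝ) - 2 < a := by rw [ha, hnN, hR]; linarith
    have hb' : 2 * (N : ℝ) - 2 < b := by rw [hb, hnN, hR]; linarith
    obtain ⟨Da, hDa0, hDa⟩ := exists_rpow_neg_le_on L e dV hdV dW hdW 𝒦.isCompact_K hΦc hΦpos a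
    obtain ⟨Db, hDb0, hDb⟩ := exists_rpow_neg_le_on L e dV hdV dW hdW 𝒦.isCompact_K hΦc hΦpos b
    have hre : ∀ s ∈ ball s₀ R, |s.re - s₀.re| < R := fun s hs =>
      lt_of_le_of_lt (by simpa only [Complex.sub_re] using Complex.abs_re_le_norm (s - s₀)) (mem_ball_iff_norm.1 hs)
    refine ⟨R, hR0, fun s hs => ?_, fun x => B * (Da * Φ (iotaLeft L e dV hdV dW hdW (ιA (placesEmbed L H S x))) ^ a +
        Db * Φ (iotaLeft L e dV hdV dW hdW (ιA (placesEmbed L H S x))) ^ b) * MQ, ?_, fun x s hs => ?_⟩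
    · have h := abs_lt.1 (hre s hs)
      simp only [Set.mem_setOf_eq]
      rw [hR] at h
      linarith [h.1]
    · exact ((((hdecay a ha').const_mul Da).add ((hdecay b hb').const_mul Db)).const_mul B).mul_const MQ
    · have h := abs_lt.1 (hre s hs)
      have has : a ≤ 2 * s.re + (n : ℝ) := by rw [ha]; linarith [h.1]
      have hbs : 2 * s.re + (n : ℝ) ≤ b := by rw [hb]; linarith [h.2]
      rw [hFdef, norm_mul]
      refine mul_le_mul (norm_apply_le_two_rpow L e dV hdV dW hdW hχu hf 0 hB hΦpos hΦ hDa hDb has hbs _) (hMQ _)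
        (norm_nonneg _) (mul_nonneg hB0 (add_nonneg (mul_nonneg hDa0.le (Real.rpow_nonneg (hΦpos _).le a))
          (mul_nonneg hDb0.le (Real.rpow_nonneg (hΦpos _).le b))))
  refine ⟨fun s hs => ?_, ?_⟩
  · -- absolute convergence at `s`: the majorant of the ball around `s` itself
    obtain ⟨R, hR0, -, bound, hbi, hbd⟩ := hdom s hs
    exact Integrable.mono' hbi (hFm s) (Eventually.of_forall fun x => hbd x s (mem_ball_self hR0))
  · -- holomorphy: dominated holomorphic parametric integral, no derivative needed
    show DifferentiableOn ℂ (fun s => ∫ x, F s x ∂(νinf.prod (Measure.pi νS))) {s : ℂ | (N : ℝ) / 2 - 1 < s.re}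
    refine Literature.Analysis.Complex.differentiableOn_integral_of_dominated (fun s _ => hFm s)
      (Eventually.of_forall fun x => ?_) fun s₀ hs₀ => ?_
    · exact ((hf.1.2 _).mul (differentiable_const _)).differentiableOn
    · obtain ⟨R, hR0, hRU, bound, hbi, hbd⟩ := hdom s₀ hs₀
      exact ⟨R, hR0, hRU, bound, hbi, Eventually.of_forall hbd⟩

end Summit.HodgeConjecture.HodgeConjecture.Cruxes.HLiu418.K2LiuZetaSHolomorphic

end
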